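import Literature.NumberTheory.PAdicHodge.BmaxPlusTUnit
import Literature.NumberTheory.PAdicHodge.BmaxPlusXiRootsNonvanishing
import HarnessLib

/-!
# `t = ([ε] − 1)·v` with `v ∈ A_maxˣ` for EVERY prime `p` (the case `p = 2`)

Topic `Literature/NumberTheory/PAdicHodge`; namespace `Literature.NumberTheory.PAdicHodge`. THEOREMS ONLY (no definition, no named
fact, no instance). Continuation of `BmaxPlusTUnit`, which factored Fontaine's `t = u·v` (`u = [ε] − 1`) in Colmez's `A_max = B_max⁺(F)` with
`v = 1 − u/2 + u²/3 − ⋯ ≡ 1 (mod p)` a unit for `p` odd. For `p = 2` the term `−u/2 = −(ξ/2)·w` (`w = u/ξ`) is NOT divisible by `2` through its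
coefficient, but `w` itself lies in `2·B⁰_max`: `w = ([ε^{1/2}] − 1)·c` and `‖(ε^{1/2} − 1)♯‖ = ‖2‖`, so `[ε^{1/2}] − 1 ∈ (2, [2♭])𝔸_inf`. Hence
`v ≡ 1 (mod 2A_max)` again.

* `uDivXi_eq_mul_of_omega_eq_xi_mul` — `w = ([ε^{1/p}] − 1)·c` when `ω = ξ·c`;
* `norm_untilt_epsRoot_sub_one_pow` — **`‖(ε^{1/p} − 1)♯‖^{p(p−1)} = ‖p‖^p`** (i.e. `v(ε^{1/p} − 1) = 1/(p−1)`); for `p = 2`: `‖(ε^{1/2}−1)♯‖ = ‖2‖` and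
  `algebraMap_uDivXi_mem_span_of_two` — **`w ∈ 2·B⁰_max`**;
* ★ `vSum_sub_one_mem_span'`, `exists_isUnit_tBmax_eq_uAinf_mul'` — **`t = ι(u)·v` with `v` a unit of `A_max`, for every `p`**.

With this, the hypothesis `p ≠ 2` disappears from Fontaine's lemma (`BmaxPlusTDivisibility`, see `BmaxPlusTDivisibilityAllPrimes`). Brick B7 of the
φ-road of line `kato_lever` (crux K★ `stmt-BirchSwinnertonDyer-22226`, memo `Cruxes/StarredOptimalManinUnitFiveSeven/Lines/kato-lever-K2-tdiv-g25.md` §2).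
Infrastructure only: BSD / K★ are not proved by any of this.

## References
* [FontaineAsterisque223III] J.-M. Fontaine, *Le corps des périodes p-adiques*, Astérisque 223 (1994), Exp. II §1.5.4, Exp. III §5.2.
* [Colmez1998Annals] P. Colmez, *Théorie d'Iwasawa des représentations de de Rham d'un corps local*, Ann. of Math. 148 (1998), §III.3.
-/

noncomputable section

open WittVector Field ValuativeRel Polynomial Finset
open Literature.AlgebraicGeometry.Resolution

namespace Literature.NumberTheory.PAdicHodge

open Literature.NumberTheory.GaloisRepresentations
open Literature.NumberTheory.GaloisRepresentations.IsNonarchimedeanLocalField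

variable {F : Type} [Field F] [ValuativeRel F] [TopologicalSpace F] [IsNonarchimedeanLocalField F]
  [CharZero F] {p : ℕ} [Fact p.Prime] [Fact (¬ IsUnit (p : integerC F))]
  [IsAdicComplete (Ideal.span {(p : integerC F)}) (integerC F)]

/-! ### `w = ([ε^{1/p}] − 1)·c` -/

/-- **`w = u/ξ = ([ε^{1/p}] − 1)·c`** when `ω = ξ·c` (`u = ([ε^{1/p}]−1)·ω`, `𝔸_inf` a domain). [cite: FontaineAsterisque223III, Exp. II §1.5.4] -/
theorem uDivXi_eq_mul_of_omega_eq_xi_mul {c : Ainf (p := p) F} (hc : omega = xi * c) :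
    (uDivXi : Ainf (p := p) F) = (teichmuller p (epsRoot : PreTilt (integerC F) p) - 1) * c := by
  refine mul_left_cancel₀ (xi_ne_zero (F := F) (p := p)) ?_
  rw [xi_mul_uDivXi, uAinf_eq_mul_omega, hc]; ring

/-! ### `‖(ε^{1/p} − 1)♯‖` -/

/-- **`‖(ε^{1/p} − 1)♯‖^{p(p−1)} = ‖p‖^p`** (`(ε^{1/p} − 1)^p = ε − 1` in the tilt and `‖(ε−1)♯‖^{p−1} = ‖p‖^p`).
[cite: FontaineAsterisque223III, Exp. II §1.5.4] -/
theorem norm_untilt_epsRoot_sub_one_pow :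
    ‖((PreTilt.untilt ((epsRoot : PreTilt (integerC F) p) - 1) : integerC F) : CompletedAlgClosure F)‖ ^ (p * (p - 1)) =
      ‖(p : CompletedAlgClosure F)‖ ^ p := by
  have hσ : (epsRoot : PreTilt (integerC F) p) - 1 = (frobeniusEquiv (PreTilt (integerC F) p) p).symm (eps - 1) := by
    rw [map_sub, map_one]; rfl
  have h := norm_untilt_frobeniusEquiv_symm_pow ((eps : PreTilt (integerC F) p) - 1) 1
  rw [pow_one, Function.iterate_one, ← hσ] at h
  rw [pow_mul, h, norm_untilt_eps_sub_one_pow]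

/-- **For `p = 2`: `‖(ε^{1/2} − 1)♯‖ = ‖2‖`.** [cite: FontaineAsterisque223III, Exp. II §1.5.4] -/
theorem norm_untilt_epsRoot_sub_one_of_two (hp : p = 2) :
    ‖((PreTilt.untilt ((epsRoot : PreTilt (integerC F) p) - 1) : integerC F) : CompletedAlgClosure F)‖ = ‖(p : CompletedAlgClosure F)‖ := by
  have h := norm_untilt_epsRoot_sub_one_pow (F := F) (p := p)
  subst hp
  rw [show 2 * (2 - 1) = 2 from rfl] at h
  exact (pow_left_inj₀ (norm_nonneg _) (norm_nonneg _) two_ne_zero).1 h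

/-- **For `p = 2`: `[ε^{1/2}] − 1 ∈ (2, ξ)·𝔸_inf`** (`ε^{1/2} − 1` is divisible by `2♭` in the valuation ring `𝒪♭`).
[cite: FontaineAsterisque223III, Exp. II §1.5.4] -/
theorem teichmuller_epsRoot_sub_one_mem_span_of_two (hp : p = 2) :
    (teichmuller p (epsRoot : PreTilt (integerC F) p) - 1 : Ainf (p := p) F) ∈ Ideal.span {(p : Ainf (p := p) F), xi} := by
  have hpF : ((PreTilt.untilt (pFlat : PreTilt (integerC F) p) : integerC F) : CompletedAlgClosure F) ≠ 0 := by
    rw [untilt_pFlat, coe_natCast_integerC]; exact natCast_C_ne_zero (Fact.out : p.Prime).ne_zero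
  obtain ⟨r, hr⟩ := exists_eq_mul_of_norm_untilt_le (b := (epsRoot : PreTilt (integerC F) p) - 1) hpF
    (by rw [norm_untilt_epsRoot_sub_one_of_two hp, untilt_pFlat, coe_natCast_integerC])
  -- `β − [p♭][r] ∈ p𝔸_inf`
  have h1 : (teichmuller p (epsRoot : PreTilt (integerC F) p) - 1 - teichmuller p pFlat * teichmuller p r : Ainf (p := p) F) ∈
      Ideal.span {(p : Ainf (p := p) F)} := by
    rw [WittVector.mem_span_p_iff_coeff_zero_eq_zero, ← WittVector.constantCoeff_apply, map_sub, map_sub, map_mul, map_one,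
      WittVector.constantCoeff_apply, teichmuller_coeff_zero, WittVector.constantCoeff_apply, teichmuller_coeff_zero,
      WittVector.constantCoeff_apply, teichmuller_coeff_zero, hr, sub_self]
  rw [span_p_xi_eq]
  have e : (teichmuller p (epsRoot : PreTilt (integerC F) p) - 1 : Ainf (p := p) F) =
      (teichmuller p epsRoot - 1 - teichmuller p pFlat * teichmuller p r) + teichmuller p pFlat * teichmuller p r := by ring
  rw [e]
  refine add_mem (Ideal.span_mono (by simp) h1) (Ideal.mul_mem_right _ _ (Ideal.subset_span (by simp)))

/-- **For `p = 2`: `w = u/ξ ∈ 2·B⁰_max`.** [cite: FontaineAsterisque223III, Exp. II §1.5.4] -/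
theorem algebraMap_uDivXi_mem_span_of_two (hp : p = 2) :
    algebraMap (Ainf (p := p) F) (bmaxZero F p) uDivXi ∈ Ideal.span {(p : bmaxZero F p)} := by
  obtain ⟨c, hc, -⟩ := exists_omega_eq_xi_mul (F := F) (p := p)
  rw [uDivXi_eq_mul_of_omega_eq_xi_mul hc, map_mul]
  exact Ideal.mul_mem_right _ _ (algebraMap_mem_span_of_mem_span_p_xi (teichmuller_epsRoot_sub_one_mem_span_of_two hp))

/-! ### `v ≡ 1 (mod p)` for every `p` -/

/-- **`d_k ∈ pℤ_p` for `k ≥ 3`, all `p`** (`v_p(k) ≤ k − 2`). [cite: FontaineAsterisque223III, Exp. III §5.2] -/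
theorem exists_d_eq_p_mul_of_three_le {d : ℕ → ℤ_[p]} (hd : ∀ k : ℕ, k ≠ 0 → (k : ℤ_[p]) * d k = (p : ℤ_[p]) ^ (k - 1)) {k : ℕ}
    (hk : 3 ≤ k) : ∃ e : ℤ_[p], d k = (p : ℤ_[p]) * e := by
  have hk0 : k ≠ 0 := by omega
  have hp := (Fact.out : p.Prime)
  have hv : k.factorization p ≤ k - 2 := by
    rcases Nat.lt_or_ge k 4 with h4 | h4
    · have hk3 : k = 3 := by omega
      subst hk3
      -- `p^{v_p(3)} ≤ 3 < 4 ≤ p²`, so `v_p(3) ≤ 1`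
      have h1 : p ^ (3 : ℕ).factorization p ≤ 3 := Nat.ordProj_le p (by norm_num)
      have h2 : 3 < p ^ 2 := lt_of_lt_of_le (by norm_num) (Nat.pow_le_pow_left hp.two_le 2)
      have h3 : (3 : ℕ).factorization p < 2 := (Nat.pow_lt_pow_iff_right hp.one_lt).1 (lt_of_le_of_lt h1 h2)
      omega
    · have := two_mul_factorization_le (p := p) k; omega
  obtain ⟨e, he⟩ := exists_natCast_mul_eq_pow hk0 hv
  refine ⟨e, mul_left_cancel₀ (Nat.cast_ne_zero.2 hk0 : (k : ℤ_[p]) ≠ 0) ?_⟩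
  rw [hd k hk0, mul_left_comm, he, ← pow_succ', show k - 2 + 1 = k - 1 by omega]

set_option maxHeartbeats 1600000 in
/-- **`V_N ≡ 1 (mod p·B⁰_max)`** for `N ≥ 1` and EVERY `p`: the terms `k ≥ 3` have `d_k ∈ pℤ_p`; the term `k = 2` is `−d_2·w·(ξ/p)` with
`d_2 = p/2 ∈ pℤ_p` for `p` odd and `w ∈ 2B⁰_max` for `p = 2`. [cite: FontaineAsterisque223III, Exp. III §5.2] -/
theorem vSum_sub_one_mem_span' {d : ℕ → ℤ_[p]} (hd : ∀ k : ℕ, k ≠ 0 → (k : ℤ_[p]) * d k = (p : ℤ_[p]) ^ (k - 1))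
    {N : ℕ} (hN : 1 ≤ N) :
    (∑ j ∈ range N, (-1) ^ j * algebraMap (Ainf (p := p) F) (bmaxZero F p) (zpToAinf (d (j + 1)) * uDivXi ^ j) * omegaB ^ j) - 1 ∈
      Ideal.span {(p : bmaxZero F p)} := by
  by_cases hp : p = 2
  swap
  · exact vSum_sub_one_mem_span hp hd hN
  obtain ⟨N, rfl⟩ := Nat.exists_eq_add_of_le' hN
  rw [sum_range_succ', pow_zero, pow_zero, pow_zero, one_mul, mul_one, mul_one, zero_add, d_one_eq_one hd, map_one, map_one,
    add_sub_cancel_right]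
  refine Ideal.sum_mem _ fun j _ => ?_
  rcases Nat.eq_zero_or_pos j with rfl | hj
  · -- the term `k = 2`: `−d_2 · w · (ξ/p)` with `w ∈ 2B⁰_max`
    rw [zero_add, pow_one, pow_one, pow_one, map_mul]
    exact Ideal.mul_mem_right _ _ (Ideal.mul_mem_left _ _ (Ideal.mul_mem_left _ _ (algebraMap_uDivXi_mem_span_of_two hp)))
  · obtain ⟨e, he⟩ := exists_d_eq_p_mul_of_three_le hd (k := j + 1 + 1) (by omega)
    rw [he, Ideal.mem_span_singleton']
    refine ⟨(-1) ^ (j + 1) * algebraMap (Ainf (p := p) F) (bmaxZero F p) (zpToAinf e * uDivXi ^ (j + 1)) * omegaB ^ (j + 1), ?_⟩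
    simp only [map_mul, map_natCast, map_pow]
    ring

set_option maxHeartbeats 1600000 in
set_option synthInstance.maxHeartbeats 400000 in
/-- ★ **`t = ι([ε] − 1)·v` with `v` a UNIT of `A_max`, for every prime `p`** (`v ≡ 1 (mod p·A_max)` and `p` lies in the Jacobson radical of the
`p`-adically complete `A_max`). [cite: FontaineAsterisque223III, Exp. III §5.2] [cite: Colmez1998Annals, §III.3] -/
theorem exists_isUnit_tBmax_eq_uAinf_mul' :
    ∃ v : BmaxPlus F p, IsUnit v ∧ tBmax (F := F) (p := p) = ainfToBmaxPlus F p uAinf * v := by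
  obtain ⟨d, hd⟩ := exists_natCast_mul_eq_pow_sub_one (p := p)
  obtain ⟨v, hv⟩ : ∃ v : BmaxPlus F p, ∀ n, AdicCompletion.evalₐ (Ideal.span {(p : bmaxZero F p)}) n v =
      Ideal.Quotient.mk _ (∑ j ∈ range (p ^ (n + 1) - 1),
        (-1) ^ j * algebraMap (Ainf (p := p) F) (bmaxZero F p) (zpToAinf (d (j + 1)) * uDivXi ^ j) * omegaB ^ j) :=
    ⟨AdicCompletion.mk (Ideal.span {(p : bmaxZero F p)}) (bmaxZero F p) ⟨_, isAdicCauchy_vSum hd⟩, fun n => AdicCompletion.evalₐ_mk _ _ _⟩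
  refine ⟨v, ?_, tBmax_eq_uAinf_mul_of_evalₐ_eq hd hv⟩
  have h1 : AdicCompletion.evalₐ (Ideal.span {(p : bmaxZero F p)}) 1 (v - 1) = 0 := by
    rw [map_sub, map_one, hv 1, ← map_one (Ideal.Quotient.mk (Ideal.span {(p : bmaxZero F p)} ^ 1)), ← map_sub,
      Ideal.Quotient.eq_zero_iff_mem, pow_one]
    refine vSum_sub_one_mem_span' hd ?_
    have : 2 ≤ p ^ (1 + 1) := le_trans (Nat.Prime.two_le Fact.out) (Nat.le_self_pow (by norm_num) p)
    omega
  obtain ⟨s, hs⟩ := (PrincipalCompletion.evalₐ_eq_zero_iff (I := Ideal.span {(p : bmaxZero F p)}) rfl (v - 1) 1).1 h1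
  rw [pow_one] at hs
  have hJ : PrincipalCompletion.xiHat (Ideal.span {(p : bmaxZero F p)}) (p : bmaxZero F p) * s ∈
      (⊥ : Ideal (BmaxPlus F p)).jacobson := by
    haveI := AdicCompletion.isAdicComplete_self (Ideal.span {(p : bmaxZero F p)}) (Submodule.fg_span_singleton _)
    refine IsAdicComplete.le_jacobson_bot ((Ideal.span {(p : bmaxZero F p)}).map (algebraMap (bmaxZero F p) (BmaxPlus F p))) ?_
    rw [PrincipalCompletion.map_eq_span (I := Ideal.span {(p : bmaxZero F p)}) rfl]
    exact Ideal.mul_mem_right _ _ (Ideal.mem_span_singleton_self _)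
  have h2 : IsUnit (PrincipalCompletion.xiHat (Ideal.span {(p : bmaxZero F p)}) (p : bmaxZero F p) * s * 1 + 1) :=
    Ideal.mem_jacobson_bot.1 hJ 1
  rw [mul_one] at h2
  rw [show v = PrincipalCompletion.xiHat (Ideal.span {(p : bmaxZero F p)}) (p : bmaxZero F p) * s + 1 by rw [← hs, sub_add_cancel]]
  exact h2

end Literature.NumberTheory.PAdicHodge

end
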